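import Summits.ResolutionOfSingularities.ResolutionOfSingularities.Theorems.RadicialJungCleanModelsKbarGlobalOfCossart1987
import Summits.ResolutionOfSingularities.ResolutionOfSingularities.Theorems.EquisingularLiftEquisingularLiftBlowupModelFourOfCP2008
import Literature.AlgebraicGeometry.CossartPiltant200819.Thm21VerbatimAssembly2008
import Literature.AlgebraicGeometry.Resolution.ChowLemmaProofs
import Literature.AlgebraicGeometry.Resolution.RegularLocusDense
import Literature.AlgebraicGeometry.Resolution.QuasiProjectiveResolution
import Literature.AlgebraicGeometry.Resolution.AlterationsResolution
import Literature.AlgebraicGeometry.Resolution.AlterationsDimension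
import Literature.AlgebraicGeometry.Resolution.PrincipalizationToResolution
import Literature.AlgebraicGeometry.Resolution.CossartFunctionNormalForm3
import Literature.AlgebraicGeometry.Motives.CartierDivisor
import HarnessLib

/-!
# Route `RadicialJung`, crux `CleanModels` (stmt-15917): the `k = k̄` slice of the crux in dimension `3` is IN PRINT —
# clean models of ALL regular threefolds over an algebraically closed field from Cossart's normal form for a RATIONAL
# function (Cossart 1987 as globalised by Posva 2024, Claim 5.1.2 / App. A §A.7) and Cossart–Piltant 2008 Thm. 2.1

Explicit-unit seat `decomp-res-hand-1` g22 (share: the printed stubs 1–4 of `Cruxes/CleanModels/Lines/Sketch.lean` rev 35).  OURS,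
def-free, counted 0.  Nothing here proves resolution of singularities in characteristic `p`: the two printed theorems enter as NAMED-FACT
HYPOTHESES (✓-typed `Literature.AlgebraicGeometry.Resolution.Cossart1987ThmRational`, p836473, reviewed against the held text; and
✓-typed `CP2008.ResolutionQuasiProjectiveThreefolds`); nothing is proved by binding them.

WHAT IS NEW.  The registered line closes the dim-3 slice of the crux by clean LOCAL UNIFORMIZATION (stubs 1–5) + PATCHING (nodes 4a–4e,
research stub 6 = X44c).  Over `k = k̄` the tree used Cossart 1987 (F-112, `Cossart1987Thm`: `ν = 0` after a modification, for a GLOBAL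
function `f` on a quasi-projective regular threefold) only along valuations, and `…KbarGlobalOfCossart1987.lean` (this seat) globally but only
for AFFINE `W`.  Posva 2024 (arXiv:2405.05735, Claim 5.1.2, proved in App. A §A.7 «Proof of Claim 5.1.2») states and proves Cossart's theorem for
an arbitrary RATIONAL function `u ∈ K(X) ∖ K(X)^p` on a regular quasi-projective threefold `X` over `k̄`: Cossart's data `𝒥, H, J, ν, …` are
invariant under `f ⇝ φ^p f` (Claim A.1.1), so the local representatives `u vᵢ^p` (`div vᵢ =` poles of `u` on an affine chart `Uᵢ`) define ONE
global ideal and Cossart's algorithm runs globally until `ν = 0` everywhere.  Reading `ν = 0` off at closed points (✓ `KbarGlobal.looseCleanRep_stalk_of_nuZeroAt`),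
generising (✓ `looseCleanAll_of_closedPoints`) and normalising (✓ `cleanModels_of_looseCleanAll`) turns Posva's model into a CLEAN MODEL of
`(W, L)` for every quasi-projective regular threefold `W` over `k̄`; Chow's lemma (✓ `ChowLemmaIntegral_holds`, kernel) and Cossart–Piltant 2008
Thm. 2.1 (projective resolution of reduced quasi-projective threefolds, typed ✓ `CP2008.ResolutionQuasiProjectiveThreefolds`) remove
«quasi-projective» (✓ `IsQuasiProjectiveOver.comp_isProjectiveOver`).  Hence:

  **on {`k` algebraically closed, `dim W ≤ 3`} the crux `CleanModels` follows from TWO PRINTED THEOREMS (Cossart 1987/Posva 2024 and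
  Cossart–Piltant 2008 Thm. 2.1) and kernel theorems — NO local uniformization, NO patching: the registered research stubs 5 (class (B))
  and 6 (X44c) and the printed stubs 1 (CJS 2020), 2 (CP 2019) and 4 (CP 2019 Thm. 1.5 (i) at `p = 2`) are not used on that slice.**

* `cleanModelsAt_of_nuZeroAt_closedPoints` — PACKAGING (every field `k` of characteristic `p`): a proper birational REGULAR `π : V → W` on
  which, at every CLOSED point, some representative `g₀ v^p` (`v ≠ 0`) of the line of a radicand `g₀` has Cossart's `ν = 0`, IS a clean model.
* `cleanModelsAt_quasiProjective_dimThree_algClosed_of_cossartRational` — quasi-projective `W`, from the Cossart/Posva statement alone.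
* `cleanModelsAt_dimThree_algClosed_of_cossartRational_of_cp2008` — ALL `W` (separated, of finite type), from Cossart/Posva + CP 2008 Thm. 2.1.
* `cleanModelsAt_dimLEThree_algClosed_of_cossartRational_of_cp2008` — `dim W ≤ 3` (dimension `≤ 2` is unconditional, ✓ F-75c).

References: Posva 2024 (arXiv:2405.05735) Claim 5.1.2, App. A §A.1.3, Claim A.1.1, §A.7 [Posva2024]; Cossart 1987 [Cossart1987];
Cossart–Piltant 2008 Thm. 2.1 [CossartPiltant2008]; Kimura–Niitsuma 1980 Thm. 3.4 [KimuraNiitsuma1980].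
-/

noncomputable section

set_option linter.dupNamespace false -- mandated namespace of this single-conjunct summit

open IsLocalRing
open Literature.AlgebraicGeometry.Resolution
open Summit.ResolutionOfSingularities.ResolutionOfSingularities.Theorems.RadicialJung.CleanModels
open CategoryTheory AlgebraicGeometry TopologicalSpace
open Literature.AlgebraicGeometry.CossartPiltant200819.CP2008
open Literature.AlgebraicGeometry.Motives

namespace Summit.ResolutionOfSingularities.ResolutionOfSingularities.Theorems.RadicialJung.CleanModels.KbarRational

/-- **PACKAGING: a regular model with `ν = 0` representatives at closed points is a clean model** (every ground field `k` of
characteristic `p`).  For `W` integral, quasi-compact and locally of finite type over `k`, a radicand `g₀ ∈ K(W)` of an element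
`y₀ ∈ L ∖ K(W)`, and a proper birational `π : V → W` with `V` integral and regular such that at every CLOSED point `x ∈ V` some
`g ∈ 𝒪_{V,x}` with `g = π^♯(g₀ v^p)` in `K(V)` (`v ∈ K(W)`, `v ≠ 0`) has `NuZeroAt g`: at EVERY point of `V` some `y ∈ L ∖ K(W)`, `y^p = G`,
has `π^♯ G` exactly clean.  Kernel: read-off at closed points (✓ `KbarGlobal.looseCleanRep_stalk_of_nuZeroAt`), pull the correction `c₀^p + c₁^p ·`
back along the bijective `π^♯`, `y := c₀' + c₁' v y₀`, generise (✓ `looseCleanAll_of_closedPoints`), normalise (✓ `cleanModels_of_looseCleanAll`).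
[folklore] -/
theorem cleanModelsAt_of_nuZeroAt_closedPoints (p : ℕ) (hp : p.Prime) (k : Type) [Field k] [CharP k p]
    (W : Scheme.{0}) [IsIntegral W] (f : W ⟶ Spec (.of k)) [QuasiCompact f] [LocallyOfFiniteType f]
    (L : Type) [Field L] [Algebra W.functionField L]
    (y₀ : L) (g₀ : W.functionField) (hy₀ : y₀ ∉ Set.range (algebraMap W.functionField L))
    (hg₀ : algebraMap W.functionField L g₀ = y₀ ^ p)
    (V : Scheme.{0}) (π : V ⟶ W) [IsIntegral V] [IsDominant π] [IsProper π]
    (hbir : IsBirational π) (hVreg : Scheme.IsRegular V)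
    (hν : ∀ x : V, IsClosed ({x} : Set V) → ∃ (v : W.functionField) (g : V.presheaf.stalk x), v ≠ 0 ∧
      algebraMap (V.presheaf.stalk x) V.functionField g = RatFn.functionFieldMap π (g₀ * v ^ p) ∧ NuZeroAt g)
    (x : V) :
    ∃ (y : L) (G : W.functionField), y ∉ Set.range (algebraMap W.functionField L) ∧
      algebraMap W.functionField L G = y ^ p ∧
      ((∃ (d m : ℕ) (hmd : m ≤ d) (t : Fin d → V.presheaf.stalk x) (a : Fin m → ℕ),
          Ideal.span (Set.range t) = maximalIdeal (V.presheaf.stalk x) ∧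
          ringKrullDim (V.presheaf.stalk x) = (d : WithBot ℕ∞) ∧ 0 < m ∧ (∀ i, ¬ p ∣ a i) ∧
          RatFn.functionFieldMap π G = ∏ i : Fin m,
            (algebraMap (V.presheaf.stalk x) V.functionField (t (Fin.castLE hmd i))) ^ (a i)) ∨
        (∃ u₀ : V.presheaf.stalk x, IsUnit u₀ ∧
          RatFn.functionFieldMap π G = algebraMap (V.presheaf.stalk x) V.functionField u₀ ∧
          ((∀ c : V.presheaf.stalk x, u₀ - c ^ p ∉ maximalIdeal (V.presheaf.stalk x)) ∨
            (∃ c : V.presheaf.stalk x, u₀ - c ^ p ∈ maximalIdeal (V.presheaf.stalk x) ∧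
              u₀ - c ^ p ∉ maximalIdeal (V.presheaf.stalk x) ^ 2)))) := by
  classical
  haveI : Fact p.Prime := ⟨hp⟩
  haveI : CharP W.functionField p := charP_stalk W f _
  have hg₀p : ∀ c : W.functionField, c ^ p ≠ g₀ := KbarGlobal.not_pthPower_of_radicand p hp y₀ hy₀ g₀ hg₀
  have hbij : Function.Bijective (RatFn.functionFieldMap π) := by
    obtain ⟨U', hU', hU'', hiso⟩ := hbir
    haveI := hiso
    exact RatFn.functionFieldMap_bijective_of_isIso_morphismRestrict π U' hU' hU''
  -- loose cleanness at the CLOSED points of `V`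
  have hclosed : ∀ x' : V, IsClosed ({x'} : Set V) → ∃ (y : L) (G : W.functionField),
      y ∉ Set.range (algebraMap W.functionField L) ∧ algebraMap W.functionField L G = y ^ p ∧
      ((∃ (d m : ℕ) (hmd : m ≤ d) (t : Fin d → V.presheaf.stalk x') (a : Fin m → ℕ)
          (u : V.presheaf.stalk x'), IsUnit u ∧
          Ideal.span (Set.range t) = maximalIdeal (V.presheaf.stalk x') ∧
          ringKrullDim (V.presheaf.stalk x') = (d : WithBot ℕ∞) ∧ 0 < m ∧ (∀ i, ¬ p ∣ a i) ∧
          RatFn.functionFieldMap π G = algebraMap (V.presheaf.stalk x') V.functionField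
            (u * ∏ i : Fin m, t (Fin.castLE hmd i) ^ (a i))) ∨
        (∃ u : V.presheaf.stalk x', IsUnit u ∧
          RatFn.functionFieldMap π G = algebraMap (V.presheaf.stalk x') V.functionField u ∧
          ∀ c : V.presheaf.stalk x', u - c ^ p ∉ maximalIdeal (V.presheaf.stalk x')) ∨
        (∃ s c : V.presheaf.stalk x',
          RatFn.functionFieldMap π G = algebraMap (V.presheaf.stalk x') V.functionField s ∧
          s - c ^ p ∈ maximalIdeal (V.presheaf.stalk x') ∧
          s - c ^ p ∉ maximalIdeal (V.presheaf.stalk x') ^ 2)) := by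
    intro x' hx'
    obtain ⟨v, g, hv, hg, hN⟩ := hν x' hx'
    -- `g` is not a `p`-th power in `K(V)`
    have hgx : ∀ c : V.functionField, c ^ p ≠ algebraMap (V.presheaf.stalk x') V.functionField g := by
      intro c hc
      obtain ⟨c', rfl⟩ := hbij.2 c
      rw [hg, ← map_pow] at hc
      have hc' : c' ^ p = g₀ * v ^ p := hbij.1 hc
      apply hg₀p (c' / v)
      rw [div_pow, hc', mul_div_assoc, div_self (pow_ne_zero _ hv), mul_one]
    haveI : LocallyOfFiniteType (π ≫ f) := inferInstance
    obtain ⟨c₀, c₁, hc₁, hforms⟩ :=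
      KbarGlobal.looseCleanRep_stalk_of_nuZeroAt p k (π ≫ f) hVreg hx' g hgx hN
    -- pull `c₀, c₁` back to `K(W)` along the bijective `π^♯`
    obtain ⟨c₀', hc₀'⟩ := hbij.2 c₀
    obtain ⟨c₁', hc₁'⟩ := hbij.2 c₁
    have hc₁'0 : c₁' ≠ 0 := by
      rintro rfl
      exact hc₁ (by rw [← hc₁', map_zero])
    obtain ⟨G, hGdef⟩ : ∃ G : W.functionField, G = c₀' ^ p + c₁' ^ p * (g₀ * v ^ p) := ⟨_, rfl⟩
    have heG : RatFn.functionFieldMap π G =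
        c₀ ^ p + c₁ ^ p * algebraMap (V.presheaf.stalk x') V.functionField g := by
      rw [hGdef, map_add, map_mul, map_pow, map_pow, hc₀', hc₁', hg]
    refine ⟨algebraMap W.functionField L c₀' + algebraMap W.functionField L (c₁' * v) * y₀, G,
      KbarGlobal.add_mul_not_mem_range y₀ hy₀ c₀' (c₁' * v) (mul_ne_zero hc₁'0 hv), ?_, ?_⟩
    · -- `G ↦ (c₀' + c₁' v y₀)^p`
      haveI : CharP L p := charP_of_injective_algebraMap (algebraMap W.functionField L).injective p
      rw [hGdef, add_pow_char]
      simp only [map_add, map_mul, map_pow, mul_pow, hg₀]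
      ring
    · rcases hforms with ⟨d', m, hmd, t', a', w, hw, ht', hd', hm, ha', heq⟩ | ⟨w, hw, heq, hres⟩ |
          ⟨s, c', heq, hm1, hm2⟩
      · exact Or.inl ⟨d', m, hmd, t', a', w, hw, ht', hd', hm, ha', by rw [heG, heq]⟩
      · exact Or.inr (Or.inl ⟨w, hw, by rw [heG, heq], hres⟩)
      · exact Or.inr (Or.inr ⟨s, c', by rw [heG, heq], hm1, hm2⟩)
  exact cleanModels_of_looseCleanAll p hp k W f L V π hbir
    (looseCleanAll_of_closedPoints p hp k W f L V π hbir hVreg hclosed) x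

/-- **`CleanModels` for QUASI-PROJECTIVE regular threefolds over `k̄`, from Cossart's normal form for a rational function
(Cossart 1987 / Posva 2024 Claim 5.1.2) ALONE.**  The hypothesis `hCR` is the typed named fact `Cossart1987ThmRational` ([Posva2024] Claim 5.1.2 and App. A §A.7: for `X` a regular
quasi-projective threefold over `k̄` and `u ∈ K(X) ∖ K(X)^p`, a projective birational regular `V → X` on which the local representatives
`u v^p` of the line of `u` have Cossart's `ν = 0` at every point — typed, weaker than print, with «proper + an isomorphism over a non-empty
open» and the pointwise `NuZeroAt`).
Conclusion: for every such `W` and every purely inseparable `L/K(W)` of degree `p`, the pointwise conclusion of the crux `CleanModels`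
(Posva's model IS a clean model: `cleanModelsAt_of_nuZeroAt_closedPoints`).
[cite: Posva2024, Claim 5.1.2 and App. A §A.7] [cite: Cossart1987, main theorem] -/
theorem cleanModelsAt_quasiProjective_dimThree_algClosed_of_cossartRational
    (hCR : Cossart1987ThmRational)
    (p : ℕ) (hp : p.Prime) (k : Type) [Field k] [CharP k p] [IsAlgClosed k]
    (W : Scheme.{0}) [IsIntegral W] (f : W ⟶ Spec (.of k)) [IsSeparated f] [LocallyOfFiniteType f]
    [QuasiCompact f] (hqp : IsQuasiProjectiveOver f) (hW : Scheme.IsRegular W) (hdim : topologicalKrullDim W = 3)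
    (L : Type) [Field L] [Algebra W.functionField L]
    [IsPurelyInseparable W.functionField L] (hdeg : Module.finrank W.functionField L = p) :
    ∃ (V : Scheme.{0}) (π : V ⟶ W) (_ : IsIntegral V) (_ : IsDominant π),
      IsProper π ∧ IsBirational π ∧ Scheme.IsRegular V ∧
      (∀ v : V, (∃ (y : L) (g : W.functionField), y ∉ Set.range (algebraMap W.functionField L) ∧
        algebraMap W.functionField L g = y ^ p ∧
        ((∃ (d m : ℕ) (hmd : m ≤ d) (t : Fin d → V.presheaf.stalk v) (a : Fin m → ℕ),
            Ideal.span (Set.range t) = maximalIdeal (V.presheaf.stalk v) ∧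
            ringKrullDim (V.presheaf.stalk v) = (d : WithBot ℕ∞) ∧ 0 < m ∧ (∀ i, ¬ p ∣ a i) ∧
            RatFn.functionFieldMap π g = ∏ i : Fin m,
              (algebraMap (V.presheaf.stalk v) V.functionField (t (Fin.castLE hmd i))) ^ (a i)) ∨
          (∃ u₀ : V.presheaf.stalk v, IsUnit u₀ ∧
            RatFn.functionFieldMap π g = algebraMap (V.presheaf.stalk v) V.functionField u₀ ∧
            ((∀ c : V.presheaf.stalk v, u₀ - c ^ p ∉ maximalIdeal (V.presheaf.stalk v)) ∨
              (∃ c : V.presheaf.stalk v, u₀ - c ^ p ∈ maximalIdeal (V.presheaf.stalk v) ∧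
                u₀ - c ^ p ∉ maximalIdeal (V.presheaf.stalk v) ^ 2)))))) := by
  haveI : Fact p.Prime := ⟨hp⟩
  haveI : CharP W.functionField p := charP_stalk W f _
  haveI : CompactSpace W := QuasiCompact.compactSpace_of_compactSpace f
  obtain ⟨-, y₀, g₀, hy₀, hg₀, hg₀p⟩ := stub_generator (K := W.functionField) (L := L) p hp hdeg
  obtain ⟨V, π, hVint, hdom, hπ, hVreg, ⟨U, hUne, hUiso⟩, hν⟩ := hCR p k W f hqp hW hdim g₀ hg₀p
  haveI := hπ
  haveI := hUiso
  obtain ⟨hbir, -⟩ := Lens5.KbarCossart.isBirational_and_denseRange π U hUne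
  exact ⟨V, π, hVint, hdom, hπ, hbir, hVreg, fun x =>
    cleanModelsAt_of_nuZeroAt_closedPoints p hp k W f L y₀ g₀ hy₀ hg₀ V π hbir hVreg (fun x' hx' => hν x') x⟩

/-- **`CleanModels` for ALL integral threefolds over `k̄` (separated, of finite type — regularity of `W` is NOT needed), from Cossart/Posva and
Cossart–Piltant 2008 Thm. 2.1.**
Chow's lemma (✓ `ChowLemmaIntegral_holds`): `W ← X₁` proper birational with `X₁` integral and quasi-projective; CP 2008 Thm. 2.1
(`h21 : CP2008.ResolutionQuasiProjectiveThreefolds`, `k̄` is differentially finite over itself): `X₁ ← X₂` projective, `X₂` regular, an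
isomorphism over `Reg X₁`, hence birational (clause (iii)) and `X₂` integral and quasi-projective (✓ `IsQuasiProjectiveOver.comp_isProjectiveOver`);
then `hCR` on `X₂` for the radicand read in `K(X₂)`, and the packaging `cleanModelsAt_of_nuZeroAt_closedPoints` for the composite `V → X₂ → X₁ → W`
(representatives transported along `(π₃ ≫ π₂ ≫ π₁)^♯ = π₃^♯ ∘ (π₂ ≫ π₁)^♯`, ✓ `RatFn.functionFieldMap_comp`).
[cite: Posva2024, Claim 5.1.2 and App. A §A.7] [cite: CossartPiltant2008, Thm 2.1 (HAL p. 3)] [cite: GortzWedhorn2020, Thm 13.100] -/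
theorem cleanModelsAt_dimThree_algClosed_of_cossartRational_of_cp2008
    (hCR : Cossart1987ThmRational)
    (h21 : ResolutionQuasiProjectiveThreefolds.{0})
    (p : ℕ) (hp : p.Prime) (k : Type) [Field k] [CharP k p] [IsAlgClosed k]
    (W : Scheme.{0}) [IsIntegral W] (f : W ⟶ Spec (.of k)) [IsSeparated f] [LocallyOfFiniteType f]
    [QuasiCompact f] (hdim : topologicalKrullDim W = 3)
    (L : Type) [Field L] [Algebra W.functionField L]
    [IsPurelyInseparable W.functionField L] (hdeg : Module.finrank W.functionField L = p) :
    ∃ (V : Scheme.{0}) (π : V ⟶ W) (_ : IsIntegral V) (_ : IsDominant π),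
      IsProper π ∧ IsBirational π ∧ Scheme.IsRegular V ∧
      (∀ v : V, (∃ (y : L) (g : W.functionField), y ∉ Set.range (algebraMap W.functionField L) ∧
        algebraMap W.functionField L g = y ^ p ∧
        ((∃ (d m : ℕ) (hmd : m ≤ d) (t : Fin d → V.presheaf.stalk v) (a : Fin m → ℕ),
            Ideal.span (Set.range t) = maximalIdeal (V.presheaf.stalk v) ∧
            ringKrullDim (V.presheaf.stalk v) = (d : WithBot ℕ∞) ∧ 0 < m ∧ (∀ i, ¬ p ∣ a i) ∧
            RatFn.functionFieldMap π g = ∏ i : Fin m,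
              (algebraMap (V.presheaf.stalk v) V.functionField (t (Fin.castLE hmd i))) ^ (a i)) ∨
          (∃ u₀ : V.presheaf.stalk v, IsUnit u₀ ∧
            RatFn.functionFieldMap π g = algebraMap (V.presheaf.stalk v) V.functionField u₀ ∧
            ((∀ c : V.presheaf.stalk v, u₀ - c ^ p ∉ maximalIdeal (V.presheaf.stalk v)) ∨
              (∃ c : V.presheaf.stalk v, u₀ - c ^ p ∈ maximalIdeal (V.presheaf.stalk v) ∧
                u₀ - c ^ p ∉ maximalIdeal (V.presheaf.stalk v) ^ 2)))))) := by
  classical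
  haveI : Fact p.Prime := ⟨hp⟩
  haveI : CharP W.functionField p := charP_stalk W f _
  obtain ⟨-, y₀, g₀, hy₀, hg₀, hg₀p⟩ := stub_generator (K := W.functionField) (L := L) p hp hdeg
  /- (1) Chow: `W ← X₁ ↪ ℙⁿ` -/
  obtain ⟨n, X₁, π₁, ι, hX₁int, hι, hπ₁prop, -, hcomm, U₀, hU₀, hU₀', hiso₀⟩ :=
    ChowLemmaIntegral_holds k W f inferInstance inferInstance inferInstance inferInstance
  haveI := hX₁int
  haveI := hπ₁prop
  haveI := hiso₀
  have hbir₁ : IsBirational π₁ := ⟨U₀, hU₀, hU₀', hiso₀⟩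
  haveI : IsDominant π₁ := hbir₁.isDominant
  let f₁ : X₁ ⟶ Spec (.of k) := π₁ ≫ f
  have hqp₁ : IsQuasiProjectiveOver f₁ := ⟨n, ι, hι, hcomm⟩
  haveI : LocallyOfFiniteType f₁ := inferInstance
  have hdim₁ : topologicalKrullDim X₁ = 3 := by
    -- birational invariance of dimension through the common open `π₁⁻¹(U₀) ≅ U₀`
    have hne : ((π₁ ⁻¹ᵁ U₀ : X₁.Opens) : Set X₁).Nonempty := hU₀'.nonempty
    haveI : Nonempty (π₁ ⁻¹ᵁ U₀ : X₁.Opens) := hne.to_subtype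
    rw [← hdim, ← topologicalKrullDim_opens_eq f₁ (π₁ ⁻¹ᵁ U₀) hne]
    exact topologicalKrullDim_eq_of_isOpenImmersion f ((π₁ ∣_ U₀) ≫ U₀.ι)
  /- (2) Cossart–Piltant 2008 Thm. 2.1: `X₁ ← X₂` projective, `X₂` regular, an isomorphism over `Reg X₁` -/
  obtain ⟨X₂, π₂, hproj, hX₂reg, ⟨U₁, hU₁, hiso₁⟩, hsnc⟩ :=
    h21 p k (Summit.ResolutionOfSingularities.ResolutionOfSingularities.Cruxes.EquisingularLift.StrataSplit.isDifferentiallyFinite_of_perfectField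
      k) X₁ f₁ hqp₁ hdim₁
  haveI := hiso₁
  haveI : IsProper π₂ := hproj.isProper
  have hd₂ : Dense ((π₂ ⁻¹ᵁ U₁ : X₂.Opens) : Set X₂) := by
    have := hsnc.dense_compl
    rw [Set.preimage_compl, compl_compl, ← hU₁] at this
    exact this
  have hbir₂ : IsBirational π₂ := isBirational_of_isIso_restrict π₂ U₁ hU₁.ge hd₂
  haveI : IsReduced X₂ := hX₂reg.isReduced
  haveI : IsIntegral X₂ := hbir₂.isIntegral
  haveI : IsDominant π₂ := hbir₂.isDominant
  let f₂ : X₂ ⟶ Spec (.of k) := π₂ ≫ f₁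
  have hqp₂ : IsQuasiProjectiveOver f₂ := hqp₁.comp_isProjectiveOver hproj
  obtain ⟨hlft₂, hsep₂, hqc₂⟩ := hqp₂.finiteType_isSeparated_quasiCompact
  haveI := hlft₂; haveI := hsep₂; haveI := hqc₂
  haveI : CompactSpace X₂ := QuasiCompact.compactSpace_of_compactSpace f₂
  haveI : LocallyOfFiniteType π₂ := inferInstance
  have hdim₂ : topologicalKrullDim X₂ = 3 := by
    have hne : ((π₂ ⁻¹ᵁ U₁ : X₂.Opens) : Set X₂).Nonempty := hd₂.nonempty
    haveI : Nonempty (π₂ ⁻¹ᵁ U₁ : X₂.Opens) := hne.to_subtype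
    rw [← hdim₁, ← topologicalKrullDim_opens_eq f₂ (π₂ ⁻¹ᵁ U₁) hne]
    exact topologicalKrullDim_eq_of_isOpenImmersion f₁ ((π₂ ∣_ U₁) ≫ U₁.ι)
  /- the radicand upstairs -/
  let π₂₁ : X₂ ⟶ W := π₂ ≫ π₁
  have hbir₂₁ : IsBirational π₂₁ := hbir₂.comp hbir₁
  haveI : IsDominant π₂₁ := hbir₂₁.isDominant
  have hbij₂₁ : Function.Bijective (RatFn.functionFieldMap π₂₁) := by
    obtain ⟨U', hU', hU'', hiso⟩ := hbir₂₁
    haveI := hiso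
    exact RatFn.functionFieldMap_bijective_of_isIso_morphismRestrict π₂₁ U' hU' hU''
  let u₂ : X₂.functionField := RatFn.functionFieldMap π₂₁ g₀
  have hu₂ : ∀ c : X₂.functionField, c ^ p ≠ u₂ := by
    intro c hc
    obtain ⟨c', rfl⟩ := hbij₂₁.2 c
    exact hg₀p c' (hbij₂₁.1 (by rw [map_pow]; exact hc))
  /- (3) Cossart/Posva on `X₂` -/
  obtain ⟨V, π₃, hVint, hdom₃, hπ₃, hVreg, ⟨U₂, hU₂ne, hiso₂⟩, hν⟩ := hCR p k X₂ f₂ hqp₂ hX₂reg hdim₂ u₂ hu₂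
  haveI := hVint
  haveI := hdom₃
  haveI := hπ₃
  haveI := hiso₂
  obtain ⟨hbir₃, -⟩ := Lens5.KbarCossart.isBirational_and_denseRange π₃ U₂ hU₂ne
  /- (4) the composite `V → W` and the transported representatives -/
  let π : V ⟶ W := π₃ ≫ π₂₁
  have hbir : IsBirational π := hbir₃.comp hbir₂₁
  haveI hdom : IsDominant π := hbir.isDominant
  haveI : IsProper π := inferInstance
  have hcomp : ∀ z : W.functionField,
      RatFn.functionFieldMap π z = RatFn.functionFieldMap π₃ (RatFn.functionFieldMap π₂₁ z) := fun z =>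
    RingHom.congr_fun (RatFn.functionFieldMap_comp π₂₁ π₃) z
  have hν' : ∀ x : V, IsClosed ({x} : Set V) → ∃ (v : W.functionField) (g : V.presheaf.stalk x), v ≠ 0 ∧
      algebraMap (V.presheaf.stalk x) V.functionField g = RatFn.functionFieldMap π (g₀ * v ^ p) ∧ NuZeroAt g := by
    intro x _
    obtain ⟨v₂, g, hv₂, hg, hN⟩ := hν x
    obtain ⟨v, rfl⟩ := hbij₂₁.2 v₂
    refine ⟨v, g, fun h0 => hv₂ (by rw [h0, map_zero]), ?_, hN⟩
    rw [hg, hcomp]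
    simp only [map_mul, map_pow, u₂]
  exact ⟨V, π, hVint, hdom, inferInstance, hbir, hVreg, fun x =>
    cleanModelsAt_of_nuZeroAt_closedPoints p hp k W f L y₀ g₀ hy₀ hg₀ V π hbir hVreg hν' x⟩

/-- **`CleanModels` on {`k` algebraically closed, `dim W ≤ 3`} from the two printed theorems** (dimension `≤ 2` is unconditional in the
tree — F-75c ✓ `stub_stacks0BICLocus` through ✓ `cleanModels_dimLETwo_of_f75c` —; dimension `3` is
`cleanModelsAt_dimThree_algClosed_of_cossartRational_of_cp2008`).  On this slice NONE of the registered skeleton's stubs 1, 2, 4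
(printed: CJS 2020, CP 2019, CP 2019 Thm. 1.5 (i) at `p = 2`), 5 (research: class (B)) and 6 (research: X44c) is used.
[cite: Posva2024, Claim 5.1.2 and App. A §A.7] [cite: CossartPiltant2008, Thm 2.1 (HAL p. 3)] [cite: StacksProject, Tag 0BIC] -/
theorem cleanModelsAt_dimLEThree_algClosed_of_cossartRational_of_cp2008
    (hCR : Cossart1987ThmRational)
    (h21 : ResolutionQuasiProjectiveThreefolds.{0})
    (p : ℕ) (hp : p.Prime) (k : Type) [Field k] [CharP k p] [IsAlgClosed k]
    (W : Scheme.{0}) [IsIntegral W] (f : W ⟶ Spec (.of k)) [IsSeparated f] [LocallyOfFiniteType f]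
    [QuasiCompact f] (hW : Scheme.IsRegular W) (hdim : topologicalKrullDim W ≤ 3)
    (L : Type) [Field L] [Algebra W.functionField L]
    [IsPurelyInseparable W.functionField L] (hdeg : Module.finrank W.functionField L = p) :
    ∃ (V : Scheme.{0}) (π : V ⟶ W) (_ : IsIntegral V) (_ : IsDominant π),
      IsProper π ∧ IsBirational π ∧ Scheme.IsRegular V ∧
      (∀ v : V, (∃ (y : L) (g : W.functionField), y ∉ Set.range (algebraMap W.functionField L) ∧
        algebraMap W.functionField L g = y ^ p ∧
        ((∃ (d m : ℕ) (hmd : m ≤ d) (t : Fin d → V.presheaf.stalk v) (a : Fin m → ℕ),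
            Ideal.span (Set.range t) = maximalIdeal (V.presheaf.stalk v) ∧
            ringKrullDim (V.presheaf.stalk v) = (d : WithBot ℕ∞) ∧ 0 < m ∧ (∀ i, ¬ p ∣ a i) ∧
            RatFn.functionFieldMap π g = ∏ i : Fin m,
              (algebraMap (V.presheaf.stalk v) V.functionField (t (Fin.castLE hmd i))) ^ (a i)) ∨
          (∃ u₀ : V.presheaf.stalk v, IsUnit u₀ ∧
            RatFn.functionFieldMap π g = algebraMap (V.presheaf.stalk v) V.functionField u₀ ∧
            ((∀ c : V.presheaf.stalk v, u₀ - c ^ p ∉ maximalIdeal (V.presheaf.stalk v)) ∨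
              (∃ c : V.presheaf.stalk v, u₀ - c ^ p ∈ maximalIdeal (V.presheaf.stalk v) ∧
                u₀ - c ^ p ∉ maximalIdeal (V.presheaf.stalk v) ^ 2)))))) := by
  rcases le_two_or_eq_three_of_le_three hdim with h2 | h3
  · exact cleanModels_dimLETwo_of_f75c stub_stacks0BICLocus p hp k W f hW L hdeg h2
  · exact cleanModelsAt_dimThree_algClosed_of_cossartRational_of_cp2008 hCR h21 p hp k W f h3 L hdeg

/-- **The `k = k̄` branch of the crux in the SKELETON'S OWN BINDER SHAPE** (appended, same seat): the conclusion of
`Theses.RadicialJung.CleanModels` for `(p, k, W, f, L)` with the crux's binders VERBATIM, under the two extra hypotheses `IsAlgClosed k` and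
`topologicalKrullDim W ≤ 3`, from the two printed theorems `Cossart1987ThmRational` (Cossart 1987 / Posva 2024 Claim 5.1.2) and
`CP2008.ResolutionQuasiProjectiveThreefolds` (Cossart–Piltant 2008 Thm. 2.1) — the one-`exact` target of a `by_cases IsAlgClosed k` in the
dim-`≤ 3` slice of a re-lined skeleton (the registered line's stubs 1, 2, 4, 5, 6 then serve the non-closed ground fields only, and stub 3 =
F-112 is superseded by its rational twin). [cite: Posva2024, Claim 5.1.2 and App. A §A.7] [cite: CossartPiltant2008, Thm 2.1 (HAL p. 3)] -/
theorem cleanModels_algClosed_dimLEThree (hCR : Cossart1987ThmRational) (h21 : ResolutionQuasiProjectiveThreefolds.{0}) :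
    ∀ p : ℕ, p.Prime → ∀ (k : Type) [Field k] [CharP k p] (W : AlgebraicGeometry.Scheme.{0}) [AlgebraicGeometry.IsIntegral W]
      (f : W ⟶ AlgebraicGeometry.Spec (.of k)) (L : Type) [Field L] [Algebra W.functionField L],
      AlgebraicGeometry.IsSeparated f → AlgebraicGeometry.LocallyOfFiniteType f → AlgebraicGeometry.QuasiCompact f →
      Literature.AlgebraicGeometry.Resolution.Scheme.IsRegular W → IsPurelyInseparable W.functionField L →
      Module.finrank W.functionField L = p → IsAlgClosed k → topologicalKrullDim W ≤ 3 →
      ∃ (V : AlgebraicGeometry.Scheme.{0}) (π : V ⟶ W) (_ : AlgebraicGeometry.IsIntegral V) (_ : AlgebraicGeometry.IsDominant π),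
        AlgebraicGeometry.IsProper π ∧ Literature.AlgebraicGeometry.Resolution.IsBirational π ∧
        Literature.AlgebraicGeometry.Resolution.Scheme.IsRegular V ∧
        (∀ v : V, (∃ (y : L) (g : W.functionField), y ∉ Set.range (algebraMap W.functionField L) ∧
          algebraMap W.functionField L g = y ^ p ∧
          ((∃ (d m : ℕ) (hmd : m ≤ d) (t : Fin d → V.presheaf.stalk v) (a : Fin m → ℕ),
              Ideal.span (Set.range t) = IsLocalRing.maximalIdeal (V.presheaf.stalk v) ∧
              ringKrullDim (V.presheaf.stalk v) = (d : WithBot ℕ∞) ∧ 0 < m ∧ (∀ i, ¬ p ∣ a i) ∧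
              Literature.AlgebraicGeometry.Motives.RatFn.functionFieldMap π g = ∏ i : Fin m,
                (algebraMap (V.presheaf.stalk v) V.functionField (t (Fin.castLE hmd i))) ^ (a i)) ∨
            (∃ u₀ : V.presheaf.stalk v, IsUnit u₀ ∧
              Literature.AlgebraicGeometry.Motives.RatFn.functionFieldMap π g =
                algebraMap (V.presheaf.stalk v) V.functionField u₀ ∧
              ((∀ c : V.presheaf.stalk v, u₀ - c ^ p ∉ IsLocalRing.maximalIdeal (V.presheaf.stalk v)) ∨
                (∃ c : V.presheaf.stalk v, u₀ - c ^ p ∈ IsLocalRing.maximalIdeal (V.presheaf.stalk v) ∧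
                  u₀ - c ^ p ∉ IsLocalRing.maximalIdeal (V.presheaf.stalk v) ^ 2)))))) := by
  intro p hp k _ _ W _ f L _ _ hs hl hq hr hpi hd halg h3
  haveI := hs; haveI := hl; haveI := hq; haveI := hpi; haveI := halg
  exact cleanModelsAt_dimLEThree_algClosed_of_cossartRational_of_cp2008 hCR h21 p hp k W f hr h3 L hd

end Summit.ResolutionOfSingularities.ResolutionOfSingularities.Theorems.RadicialJung.CleanModels.KbarRational

end
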